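import Mathlib
import HarnessLib
import Summits.HubbardSuperconductivity.HubbardSuperconductivity.Theorems.KLProgrammeC4aPartnerBandTangencyDefect

/-!
# Route `KLProgramme` — crux C4a, S3 brick (B2, GENERIC CONFIGURATIONS — the CROSSINGS): on the co-moving loop the two points where BOTH the loop level and the partner level
# vanish are explicit — the loop at `k = Φ(0,θ)` (partner `q′ = Φ(ρ,ϑ+θ)`, level `ρ`) and the loop at `q′` (partner `k`, level `0`) — and the slope `∂_φ ē` there is an explicit
# transversality number `De_K(partner)[tangent at the loop point]`

Cell `gate-hubbard-kl`, lane hubbard-kl-c4a-1 (g6); helper for stub (C) `stub_twoLeg_curvature` of the engine-flow child `KLRegimeEngineV17F2`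
(stmt-HubbardSuperconductivity-20437); memo HOME/hubbard-kl-c4a-1/C4A-PLAN.md §24.4 (iii), §24.10.  The generic-region estimate of (B4) integrates by parts in the loop angle φ;
this needs `∂_φ ē ≠ 0` where `ē` is small.  On the pp loop `p = Φ(e, φ+θ)` with partner `S − p`, `S = Φ(0,θ) + Φ(ρ,ϑ+θ)`: the crossings `{e = 0} ∩ {ē ∈ levels of the two legs}`
are `(e,φ) = (0,0)` (`p = k`, partner `q′`, `ē = ρ`) and `(e,φ) = (ρ,ϑ)` (`p = q′`, partner `k`, `ē = 0`); the angular slopes there are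
`−De_K(q′)[∂_sΦ(0,θ)]` and `−De_K(k)[∂_sΦ(ρ,ϑ+θ)]` — at `ρ = 0` these are `|∇e_K|·sin∠(τ(θ), τ(ϑ+θ))`, which vanish exactly at `ϑ ∈ {0, π}` = (T), (C) (memo §24.10).
ph twin: crossings at `(0,0)` (partner `Φ(0,θ+…)`… namely `Φ(0,θ) − D(0) = Φ(ρ,ϑ+θ)`, level `ρ`) and at `(ρ, ϑ+π)` (`p = −q′`, partner `−k`, level `0`).

* `partnerBand_pp_at_k`, `partnerBand_pp_at_q`, `partnerBand_ph_at_k`, `partnerBand_ph_at_neg_q` — the crossing VALUES (exact, all configurations);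
* `hasDerivAt_partnerBand_pp_angle`, `hasDerivAt_partnerBand_ph_angle` — the angular slope of the partner band at any loop point (chain rule);
* `deriv_partnerBand_pp_angle_at_k/_at_q`, `deriv_partnerBand_ph_angle_at_k/_at_neg_q` — the transversality numbers at the crossings.

Pure bookkeeping on landed objects; nothing about the model's sizes; nothing asserts superconductivity.  References: FST II CPAM 51 (1998) §3; BGM 2006 §2.4 (2.40) [cite: BenfattoGiulianiMastropietro2006].
-/

noncomputable section

namespace Summit.HubbardSuperconductivity.HubbardSuperconductivity.Theorems.C4a

set_option linter.dupNamespace false -- summit = problem name (single-conjunct summit), D-0017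

open Real Set Filter
open scoped Topology
open Literature.MathematicalPhysics.QuantumLattice Literature.MathematicalPhysics.QuantumLattice.BandSectorCounting Literature.Probability.LatticeModels
open Summit.HubbardSuperconductivity.HubbardSuperconductivity.Theorems.KLRegimeSplit
open Summit.HubbardSuperconductivity.HubbardSuperconductivity.Theorems.DispersionFlow
open Summit.HubbardSuperconductivity.HubbardSuperconductivity.Theorems.PerturbedFermiCurve

section Sizes

variable {K : TrigPolyC4v} {A : ℝ} (hA : ∀ p : Momentum, ∀ j ≤ 2, ‖iteratedFDeriv ℝ j (frameShift K) p‖ ≤ A)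
  (hd : klCurveD ≤ (bandBounds (show (-4 : ℝ) < -1.1 by norm_num) (show (-1.1 : ℝ) ≤ -0.1 by norm_num)
    (show (-0.1 : ℝ) < 0 by norm_num)).Dtmin - 2 * A)
  {μ r : ℝ} (hr : 0 < r) (hlo : (-1.1 : ℝ) < μ - r - A) (hhi : μ + r + A < -0.1)
include hA hd hr hlo hhi

/-! ## §1 The crossing values -/

omit hd hr in
/-- **pp crossing at the loop point `k`**: the loop at `(e,φ) = (0,0)` (`p = Φ(0,θ) = k`) has partner `q′ = Φ(ρ,ϑ+θ)`, of level `ρ`: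
`e_K(S_{ρ,ϑ,θ}(0) − Φ(0, 0+θ)) = ρ`. -/
theorem partnerBand_pp_at_k {ρ : ℝ} (hρ : |ρ| < r) (ϑ θ : ℝ) : frameLevel μ K (pairSumPath μ K ρ ϑ θ 0 - levelPoint μ K 0 (0 + θ)) = ρ := by
  rw [show pairSumPath μ K ρ ϑ θ 0 - levelPoint μ K 0 (0 + θ) = levelPoint μ K ρ (ϑ + θ) by simp only [pairSumPath, zero_add, add_zero]; abel]
  exact frameLevel_levelPoint_tube (bandBounds (show (-4 : ℝ) < -1.1 by norm_num) (show (-1.1 : ℝ) ≤ -0.1 by norm_num) (show (-0.1 : ℝ) < 0 by norm_num)) hA hlo hhi hρ _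

omit hd in
/-- **pp crossing at the loop point `q′`**: the loop at `(e,φ) = (ρ,ϑ)` (`p = Φ(ρ,ϑ+θ) = q′`) has partner `k = Φ(0,θ)`, of level `0`:
`e_K(S_{ρ,ϑ,θ}(0) − Φ(ρ, ϑ+θ)) = 0`. -/
theorem partnerBand_pp_at_q (ρ ϑ θ : ℝ) : frameLevel μ K (pairSumPath μ K ρ ϑ θ 0 - levelPoint μ K ρ (ϑ + θ)) = 0 := by
  rw [show pairSumPath μ K ρ ϑ θ 0 - levelPoint μ K ρ (ϑ + θ) = levelPoint μ K 0 θ by simp only [pairSumPath, add_zero]; abel]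
  exact frameLevel_levelPoint_zero (bandBounds (show (-4 : ℝ) < -1.1 by norm_num) (show (-1.1 : ℝ) ≤ -0.1 by norm_num) (show (-0.1 : ℝ) < 0 by norm_num)) hA hr hlo hhi _

omit hd hr in
/-- **ph crossing at the loop point `k`**: the loop at `(e,φ) = (0,0)` has partner `Φ(0,θ) − D_{ρ,ϑ,θ}(0) = Φ(ρ,ϑ+θ) = q′`, of level `ρ`. -/
theorem partnerBand_ph_at_k {ρ : ℝ} (hρ : |ρ| < r) (ϑ θ : ℝ) : frameLevel μ K (levelPoint μ K 0 (0 + θ) - pairDiffPath μ K ρ ϑ θ 0) = ρ := by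
  rw [show levelPoint μ K 0 (0 + θ) - pairDiffPath μ K ρ ϑ θ 0 = levelPoint μ K ρ (ϑ + θ) by simp only [pairDiffPath, zero_add, add_zero]; abel]
  exact frameLevel_levelPoint_tube (bandBounds (show (-4 : ℝ) < -1.1 by norm_num) (show (-1.1 : ℝ) ≤ -0.1 by norm_num) (show (-0.1 : ℝ) < 0 by norm_num)) hA hlo hhi hρ _

omit hd in
/-- **ph crossing at the loop point `−q′`**: the loop at `(e,φ) = (ρ, ϑ+π)` (`p = Φ(ρ,ϑ+π+θ) = −q′`) has partner `−k`, of level `0` (`e_K` even). -/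
theorem partnerBand_ph_at_neg_q (ρ ϑ θ : ℝ) : frameLevel μ K (levelPoint μ K ρ (ϑ + π + θ) - pairDiffPath μ K ρ ϑ θ 0) = 0 := by
  rw [show ϑ + π + θ = (ϑ + θ) + π by ring, levelPoint_add_pi,
    show -levelPoint μ K ρ (ϑ + θ) - pairDiffPath μ K ρ ϑ θ 0 = -levelPoint μ K 0 θ by simp only [pairDiffPath, add_zero]; abel, frameLevel_neg]
  exact frameLevel_levelPoint_zero (bandBounds (show (-4 : ℝ) < -1.1 by norm_num) (show (-1.1 : ℝ) ≤ -0.1 by norm_num) (show (-0.1 : ℝ) < 0 by norm_num)) hA hr hlo hhi _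

/-! ## §2 The angular slope of the partner band -/

omit hr in
/-- **The angular slope of the pp partner band** at any loop point: `∂_φ e_K(S(0) − Φ(e, φ+θ)) = −De_K(S(0) − Φ(e,φ+θ))[∂_sΦ(e, φ+θ)]`. -/
theorem hasDerivAt_partnerBand_pp_angle {ρ : ℝ} {e : ℝ} (he : |e| < r) (ϑ θ φ : ℝ) :
    HasDerivAt (fun ψ : ℝ => frameLevel μ K (pairSumPath μ K ρ ϑ θ 0 - levelPoint μ K e (ψ + θ)))
      (-fderiv ℝ (frameLevel μ K) (pairSumPath μ K ρ ϑ θ 0 - levelPoint μ K e (φ + θ)) (iteratedDeriv 1 (levelPoint μ K e) (φ + θ))) φ := by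
  have hF : DifferentiableAt ℝ (frameLevel μ K) (pairSumPath μ K ρ ϑ θ 0 - levelPoint μ K e (φ + θ)) :=
    ((EngineV8.contDiff_frameLevel μ K (n := 1)).differentiable one_ne_zero) _
  have hγ : HasDerivAt (fun ψ : ℝ => levelPoint μ K e (ψ + θ)) (iteratedDeriv 1 (levelPoint μ K e) (φ + θ)) φ :=
    HasDerivAt.comp_add_const φ θ (hasDerivAt_levelPoint_angle hA hd hlo hhi he (φ + θ))
  have hin : HasDerivAt (fun ψ : ℝ => pairSumPath μ K ρ ϑ θ 0 - levelPoint μ K e (ψ + θ)) (-iteratedDeriv 1 (levelPoint μ K e) (φ + θ)) φ := by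
    have h := (hasDerivAt_const φ (pairSumPath μ K ρ ϑ θ 0)).sub hγ
    rwa [zero_sub] at h
  have h := hF.hasFDerivAt.comp_hasDerivAt φ hin
  rwa [map_neg] at h

omit hr in
/-- **The angular slope of the ph partner band** at any loop point: `∂_φ e_K(Φ(e, φ+θ) − D(0)) = De_K(Φ(e,φ+θ) − D(0))[∂_sΦ(e, φ+θ)]`. -/
theorem hasDerivAt_partnerBand_ph_angle {ρ : ℝ} {e : ℝ} (he : |e| < r) (ϑ θ φ : ℝ) :
    HasDerivAt (fun ψ : ℝ => frameLevel μ K (levelPoint μ K e (ψ + θ) - pairDiffPath μ K ρ ϑ θ 0))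
      (fderiv ℝ (frameLevel μ K) (levelPoint μ K e (φ + θ) - pairDiffPath μ K ρ ϑ θ 0) (iteratedDeriv 1 (levelPoint μ K e) (φ + θ))) φ := by
  have hF : DifferentiableAt ℝ (frameLevel μ K) (levelPoint μ K e (φ + θ) - pairDiffPath μ K ρ ϑ θ 0) :=
    ((EngineV8.contDiff_frameLevel μ K (n := 1)).differentiable one_ne_zero) _
  have hγ : HasDerivAt (fun ψ : ℝ => levelPoint μ K e (ψ + θ)) (iteratedDeriv 1 (levelPoint μ K e) (φ + θ)) φ :=
    HasDerivAt.comp_add_const φ θ (hasDerivAt_levelPoint_angle hA hd hlo hhi he (φ + θ))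
  have hin : HasDerivAt (fun ψ : ℝ => levelPoint μ K e (ψ + θ) - pairDiffPath μ K ρ ϑ θ 0) (iteratedDeriv 1 (levelPoint μ K e) (φ + θ)) φ := by
    have h := hγ.sub (hasDerivAt_const φ (pairDiffPath μ K ρ ϑ θ 0))
    rwa [sub_zero] at h
  exact hF.hasFDerivAt.comp_hasDerivAt φ hin

/-! ## §3 The transversality numbers at the crossings -/

/-- **pp slope at `k`**: `∂_φ|₀ e_K(S(0) − Φ(0, φ+θ)) = −De_K(q′)[∂_sΦ(0,θ)]`, `q′ = Φ(ρ,ϑ+θ)`. -/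
theorem deriv_partnerBand_pp_angle_at_k (ρ ϑ θ : ℝ) :
    deriv (fun ψ : ℝ => frameLevel μ K (pairSumPath μ K ρ ϑ θ 0 - levelPoint μ K 0 (ψ + θ))) 0 =
      -fderiv ℝ (frameLevel μ K) (levelPoint μ K ρ (ϑ + θ)) (iteratedDeriv 1 (levelPoint μ K 0) θ) := by
  have h0 : |(0 : ℝ)| < r := by simpa using hr
  rw [(hasDerivAt_partnerBand_pp_angle hA hd hlo hhi (ρ := ρ) h0 ϑ θ 0).deriv, zero_add,
    show pairSumPath μ K ρ ϑ θ 0 - levelPoint μ K 0 θ = levelPoint μ K ρ (ϑ + θ) by simp only [pairSumPath, add_zero]; abel]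

omit hr in
/-- **pp slope at `q′`**: `∂_φ|_ϑ e_K(S(0) − Φ(ρ, φ+θ)) = −De_K(k)[∂_sΦ(ρ,ϑ+θ)]`, `k = Φ(0,θ)`. -/
theorem deriv_partnerBand_pp_angle_at_q {ρ : ℝ} (hρ : |ρ| < r) (ϑ θ : ℝ) :
    deriv (fun ψ : ℝ => frameLevel μ K (pairSumPath μ K ρ ϑ θ 0 - levelPoint μ K ρ (ψ + θ))) ϑ =
      -fderiv ℝ (frameLevel μ K) (levelPoint μ K 0 θ) (iteratedDeriv 1 (levelPoint μ K ρ) (ϑ + θ)) := by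
  rw [(hasDerivAt_partnerBand_pp_angle hA hd hlo hhi (ρ := ρ) hρ ϑ θ ϑ).deriv,
    show pairSumPath μ K ρ ϑ θ 0 - levelPoint μ K ρ (ϑ + θ) = levelPoint μ K 0 θ by simp only [pairSumPath, add_zero]; abel]

/-- **ph slope at `k`**: `∂_φ|₀ e_K(Φ(0, φ+θ) − D(0)) = De_K(q′)[∂_sΦ(0,θ)]`. -/
theorem deriv_partnerBand_ph_angle_at_k (ρ ϑ θ : ℝ) :
    deriv (fun ψ : ℝ => frameLevel μ K (levelPoint μ K 0 (ψ + θ) - pairDiffPath μ K ρ ϑ θ 0)) 0 =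
      fderiv ℝ (frameLevel μ K) (levelPoint μ K ρ (ϑ + θ)) (iteratedDeriv 1 (levelPoint μ K 0) θ) := by
  have h0 : |(0 : ℝ)| < r := by simpa using hr
  rw [(hasDerivAt_partnerBand_ph_angle hA hd hlo hhi (ρ := ρ) h0 ϑ θ 0).deriv, zero_add,
    show levelPoint μ K 0 θ - pairDiffPath μ K ρ ϑ θ 0 = levelPoint μ K ρ (ϑ + θ) by simp only [pairDiffPath, add_zero]; abel]

omit hr in
/-- **ph slope at `−q′`**: `∂_φ|_{ϑ+π} e_K(Φ(ρ, φ+θ) − D(0)) = De_K(−k)[∂_sΦ(ρ, ϑ+π+θ)]`. -/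
theorem deriv_partnerBand_ph_angle_at_neg_q {ρ : ℝ} (hρ : |ρ| < r) (ϑ θ : ℝ) :
    deriv (fun ψ : ℝ => frameLevel μ K (levelPoint μ K ρ (ψ + θ) - pairDiffPath μ K ρ ϑ θ 0)) (ϑ + π) =
      fderiv ℝ (frameLevel μ K) (-levelPoint μ K 0 θ) (iteratedDeriv 1 (levelPoint μ K ρ) (ϑ + π + θ)) := by
  rw [(hasDerivAt_partnerBand_ph_angle hA hd hlo hhi (ρ := ρ) hρ ϑ θ (ϑ + π)).deriv,
    show levelPoint μ K ρ (ϑ + π + θ) - pairDiffPath μ K ρ ϑ θ 0 = -levelPoint μ K 0 θ by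
      rw [show ϑ + π + θ = (ϑ + θ) + π by ring, levelPoint_add_pi]; simp only [pairDiffPath, add_zero]; abel]

end Sizes

end Summit.HubbardSuperconductivity.HubbardSuperconductivity.Theorems.C4a

end
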